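import Summits.QuantumFields.YangMills.Theorems.IR.PressureMonotoneTMLinearFloor
import Summits.QuantumFields.YangMills.Theorems.IR.SiteRPFreeCubeDoubling

/-!
# Pressure-monotone-TM supplier, file 3∕4: the LOGARITHMIC volume floor from reflection-positivity doubling of free cubes, and the hook

Landed for item `stmt-QuantumFields-19354` (`--supports … --as helper`) by the LEAD prover ab-p1 under director-ym RULING g9-№2 ∕ №14 (3)
(critic ym-ir-crit-2 03:04:13Z ∕ 03:14:37Z: PASS as supplier); authored by ideator ym-ir-idea-5 g7, split of the sorry-free workfile
`Cruxes/IR/Lines/pressure_monotone_tm.lean` v5 (Part B = `Cruxes/IR/Lines/rp_doubling.lean`) per `Cruxes/IR/Lines/pressure_monotone_tm_LANDING.md`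
(eight files: `SiteRPGeometry` → `SiteRPDoubling` → `SiteRPZdBoxes` → `SiteRPFreeCubeDoubling`; `PressureMonotoneTMFloor` → `…LinearFloor` → `…LogFloor` → `…Equipartition`).

Content (§5–§6): `FreeCubeRPDoubling[All]`, `iterSide`, `pow_le_of_doubling`, `log_freeCube_le_of_doubling` (`log Z(B_m) ≤ (m−1)⁴ f(β)`), `torusLogPartition_le_log_freeCube`,
`torusLogPartition_le_of_doubling`, `logFloor`, `logFloor_le_linFloor`, `increment_bound_log_of_tendsto`, `freeEnergyIncrementFrom_logFloor`; §6 `freeCubeRPDoublingAll_holds`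
(from `RPDoubling.zdPartitionFunction_halfOpenBox_pow_sixteen_le`) and ★ `freeEnergyIncrementFrom_logFloor_holds : FreeEnergyIncrementFrom logFloor` (NO hypothesis).

HONESTY.  Supplier ∕ kinematic content only (holds for `U(1)` too): nothing here proves the Yang–Mills mass gap (Clay), `BalabanLadder.IR`,
`BalabanLadder.NT` or a lattice gap; R4 closes only the conditional finite-𝕋⁴ rung `BalabanLadder.UV`.
-/

noncomputable section

open scoped Topology
open Filter MeasureTheory
open Literature.MathematicalPhysics.QuantumFieldTheory Literature.MathematicalPhysics.QuantumLattice
open Summit.QuantumFields.YangMills.Cruxes.IR.AspectBootstrap (HasSpectralDatum IsAxisSymmetric mul_log_le phi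
  phi_ge_of_lower axisSymmetric)

namespace Summit.QuantumFields.YangMills.Cruxes.IR.PressureMonotoneTM

open Summit.QuantumFields.YangMills.Cruxes.IR.LargeFieldRarityChessboard (FreeEnergyIncrementFrom)

/-! ## §5 The LOGARITHMIC volume floor from reflection-positivity DOUBLING OF FREE CUBES

The lens-native improvement of §4.  SITE-reflection positivity of the product Haar measure (reflection `θ` in a
lattice hyperplane through sites; the in-plane links are fixed by `θ`, the in-plane plaquettes enter the half-weight
`F` with exponent `½`) gives, for the free-boundary cube `B_m` (`m` sites per side) and `β ≥ 0`, the Cauchy–Schwarz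
bound `Z(B_m)² ≤ (∫ F)² ≤ ∫ F·θF = Z(B_m ∪ θB_m)` — the doubled box with `2m − 1` sites in the reflected direction and
ALL its plaquettes (no plaquette of `B ∪ θB` crosses the plane).  Doubling in the four directions,
`Z(B_m)^{16} ≤ Z(B_{2m−1})`, and iterating (`m_k − 1 = 2^k (m − 1)`) against Chatterjee's Lemma 17.5 at `k → ∞`:

  `log Z(B_m) ≤ (m − 1)⁴ · f(β)`   — NO `β`-cost at all (exact in `d = 2`, where `Z(B_m) = z(β)^{(m−1)²}`).

With the one-sided periodisation `Z_{Λ_L,β} ≤ Z(B_{L−1})` (dropping plaquettes is free for `β ≥ 0`, proved below) the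
torus ceiling becomes `log Z_{Λ_L,β} ≤ (L−2)⁴ f(β)`, the excess `e_L(β) ≤ (L⁴ − (L−2)⁴)|f(β)| ≤ 8L³ (ν log β + C)`,
and idea-4's `(FE)` holds above the LOGARITHMIC floor `⌈log β⌉₊ + 2`.  The doubling inequality itself
(`FreeCubeRPDoubling`, a statement about the product Haar measure, continuity and unitarity of `ρ` only) is TYPED here
as the single hypothesis of this section; everything downstream of it is proved.  References: Fröhlich–Israel–Lieb–Simon,
Commun. Math. Phys. 62 (1978) 1, §4 (reflection positivity for site reflections); Osterwalder–Seiler 1978 §3; Seiler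
LNP 159 §2; Montvay–Münster §4.2.3 (site-reflection positivity of the Wilson action). -/

section LogFloor

variable {G : Type} [Group G] [TopologicalSpace G] [IsTopologicalGroup G] [CompactSpace G]
  [MeasurableSpace G] [BorelSpace G]

open Literature.Probability.LatticeModels (halfOpenBox Torus.proj)

/-- **Free-cube RP doubling (typed hypothesis of §5).**  For the free-boundary Wilson partition function of the cube
with `m` sites per side (`zdPartitionFunction ρ β (halfOpenBox 4 m)`): `Z(B_m)^{16} ≤ Z(B_{2m−1})` for every `m ≥ 1`
(four successive site reflections; classical consequence of reflection positivity of the product Haar measure). -/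
def FreeCubeRPDoubling {N : ℕ} (ρ : G →* Matrix (Fin N) (Fin N) ℂ) (β : ℝ) : Prop :=
  ∀ m : ℕ, 1 ≤ m →
    (zdPartitionFunction ρ β (halfOpenBox 4 m)).toReal ^ 16 ≤
      (zdPartitionFunction ρ β (halfOpenBox 4 (2 * m - 1))).toReal

/-- The iterated side length `m_k = 2^k (m − 1) + 1` (`m_{k+1} = 2 m_k − 1`). -/
def iterSide (m k : ℕ) : ℕ := 2 ^ k * (m - 1) + 1

/-- `iterSide m 0 = m` (for `1 ≤ m`). -/
theorem iterSide_zero {m : ℕ} (hm : 1 ≤ m) : iterSide m 0 = m := by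
  unfold iterSide; simp; omega

/-- The doubling recursion of the iterated side: `iterSide m (k+1) = 2·iterSide m k − 1`. -/
theorem iterSide_succ (m k : ℕ) : iterSide m (k + 1) = 2 * iterSide m k - 1 := by
  unfold iterSide
  have : 2 ^ (k + 1) * (m - 1) = 2 * (2 ^ k * (m - 1)) := by rw [pow_succ]; ring
  omega

/-- `1 ≤ iterSide m k`. -/
theorem one_le_iterSide (m k : ℕ) : 1 ≤ iterSide m k := by unfold iterSide; omega

/-- Iterating the doubling: `Z(B_m)^{16^k} ≤ Z(B_{m_k})`. -/
theorem pow_le_of_doubling {N : ℕ} (ρ : G →* Matrix (Fin N) (Fin N) ℂ)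
    {β : ℝ} (hD : FreeCubeRPDoubling ρ β) {m : ℕ} (hm : 1 ≤ m) (k : ℕ) :
    (zdPartitionFunction ρ β (halfOpenBox 4 m)).toReal ^ (16 ^ k) ≤
      (zdPartitionFunction ρ β (halfOpenBox 4 (iterSide m k))).toReal := by
  induction k with
  | zero => rw [pow_zero, pow_one, iterSide_zero hm]
  | succ k ih =>
    have h0 : 0 ≤ (zdPartitionFunction ρ β (halfOpenBox 4 m)).toReal ^ (16 ^ k) :=
      pow_nonneg ENNReal.toReal_nonneg _
    calc (zdPartitionFunction ρ β (halfOpenBox 4 m)).toReal ^ (16 ^ (k + 1))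
        = ((zdPartitionFunction ρ β (halfOpenBox 4 m)).toReal ^ (16 ^ k)) ^ 16 := by
          rw [pow_succ, pow_mul]
      _ ≤ (zdPartitionFunction ρ β (halfOpenBox 4 (iterSide m k))).toReal ^ 16 :=
          pow_le_pow_left₀ h0 ih 16
      _ ≤ (zdPartitionFunction ρ β (halfOpenBox 4 (iterSide m (k + 1)))).toReal := by
          rw [iterSide_succ]; exact hD _ (one_le_iterSide m k)

/-- Positivity of the free-cube partition function (as a real number). -/
theorem zdPartitionFunction_toReal_pos [SecondCountableTopology G] {N : ℕ} (ρ : G →* Matrix (Fin N) (Fin N) ℂ)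
    (hρ : Continuous ρ) (β : ℝ) (n : ℕ) : 0 < (zdPartitionFunction ρ β (halfOpenBox 4 n)).toReal := by
  rw [ChatterjeeFreeEnergy.zdPartitionFunction_toReal_eq ρ hρ β n]
  exact FreeEnergy.zdZ_pos ρ hρ β _

/-- `f(β) ≤ 0` for `β ≥ 0` (from the exact floor `2⁴ f ≤ log Z_{Λ_2} ≤ 0`). -/
theorem freeEnergyDensity_nonpos (r : LatticeRep G) {β : ℝ} (hβ : 0 ≤ β) : freeEnergyDensity 4 r.ρ β ≤ 0 := by
  haveI : SecondCountableTopology G :=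
    (r.continuous.isClosedEmbedding r.injective).isEmbedding.secondCountableTopology
  have h1 := volume_mul_freeEnergyDensity_le_torusLogPartition r hβ 2 le_rfl
  have h2 : torusLogPartition 4 r.ρ β 2 ≤ 0 := by
    rw [torusLogPartition_eq_log]
    exact Real.log_nonpos (wilsonFinTorusPartition_pos r.continuous β _ _ _ _).le
      (wilsonFinTorusPartition_le_one_of_nonneg r.ρ r.continuous hβ _ _ _ _)
  push_cast at h1
  nlinarith

/-- **The RP ceiling for free cubes**: under the doubling hypothesis, `log Z(B_m) ≤ (m − 1)⁴ f(β)` for every `m ≥ 1`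
(Chatterjee's Lemma 17.5 along `m_k = 2^k(m−1)+1`, divided by `16^k`, `k → ∞`). -/
theorem log_freeCube_le_of_doubling (r : LatticeRep G) {β : ℝ} (hβ : 0 ≤ β) (hD : FreeCubeRPDoubling r.ρ β)
    {m : ℕ} (hm : 1 ≤ m) :
    Real.log (zdPartitionFunction r.ρ β (halfOpenBox 4 m)).toReal ≤ ((m : ℝ) - 1) ^ 4 * freeEnergyDensity 4 r.ρ β := by
  haveI : SecondCountableTopology G :=
    (r.continuous.isClosedEmbedding r.injective).isEmbedding.secondCountableTopology
  have hM : ∀ g, |(r.ρ g).trace.re| ≤ (r.N : ℝ) := fun g => by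
    simpa [Fintype.card_fin] using
      Literature.RepresentationTheory.CompactGroups.CompactGroup.abs_re_trace_le_card r.ρ r.continuous g
  set f := freeEnergyDensity 4 r.ρ β with hf
  set K' : ℝ := |β| * ((r.N : ℝ) + r.N) * Fintype.card {q : Fin 4 × Fin 4 // q.1 < q.2} * (4 + 2) with hK'
  have hM0 : (0 : ℝ) ≤ r.N := Nat.cast_nonneg _
  have hK'0 : 0 ≤ K' := by positivity
  have hf0 : f ≤ 0 := freeEnergyDensity_nonpos r hβ
  have hm1 : (0 : ℝ) ≤ (m : ℝ) - 1 := by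
    have : (1 : ℝ) ≤ m := by exact_mod_cast hm
    linarith
  -- the bound at level `k`
  have hk : ∀ k : ℕ, Real.log (zdPartitionFunction r.ρ β (halfOpenBox 4 m)).toReal ≤
      ((m : ℝ) - 1) ^ 4 * f + K' * ((m : ℝ) + 1) ^ 3 * (1 / 2 : ℝ) ^ k := by
    intro k
    have hZ := zdPartitionFunction_toReal_pos r.ρ r.continuous β m
    have hZk := zdPartitionFunction_toReal_pos r.ρ r.continuous β (iterSide m k)
    -- logs of the iterated doubling
    have h1 : (16 : ℝ) ^ k * Real.log (zdPartitionFunction r.ρ β (halfOpenBox 4 m)).toReal ≤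
        Real.log (zdPartitionFunction r.ρ β (halfOpenBox 4 (iterSide m k))).toReal := by
      have := Real.log_le_log (pow_pos hZ _) (pow_le_of_doubling r.ρ hD hm k)
      rwa [Real.log_pow, Nat.cast_pow, Nat.cast_ofNat] at this
    -- Lemma 17.5 at side `m_k`
    have h2 := ChatterjeeFreeEnergy.le_freeEnergyDensity (d := 4) r.ρ r.continuous hM β (iterSide m k)
    have hs0 : (0 : ℝ) < (iterSide m k : ℝ) + 1 := by positivity
    have hs4 : (0 : ℝ) < ((iterSide m k : ℝ) + 1) ^ 4 := by positivity
    have h2a := sub_le_iff_le_add.1 h2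
    rw [div_le_iff₀ hs4] at h2a
    have e : (f + |β| * ((r.N : ℝ) + (r.N : ℝ)) * (Fintype.card {q : Fin 4 × Fin 4 // q.1 < q.2} : ℝ) *
        ((4 : ℕ) + 2 : ℝ) / ((iterSide m k : ℝ) + 1)) * ((iterSide m k : ℝ) + 1) ^ 4 =
        ((iterSide m k : ℝ) + 1) ^ 4 * f + K' * ((iterSide m k : ℝ) + 1) ^ 3 := by
      rw [hK']; push_cast; field_simp; try ring
    have h3 : Real.log (zdPartitionFunction r.ρ β (halfOpenBox 4 (iterSide m k))).toReal ≤
        ((iterSide m k : ℝ) + 1) ^ 4 * f + K' * ((iterSide m k : ℝ) + 1) ^ 3 := by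
      have := h2a; push_cast at this e; linarith [this, e]
    -- arithmetic of `m_k`: `(m_k + 1) = 2^k ((m-1) + 2/2^k)`
    set q : ℝ := (1 / 2 : ℝ) ^ k with hq
    set t : ℝ := (2 : ℝ) ^ k with ht
    have hpow : (0 : ℝ) < t := by positivity
    have htq : t * q = 1 := by rw [ht, hq, ← mul_pow]; norm_num
    have hq0 : (0 : ℝ) ≤ q := by positivity
    have hq1 : q ≤ 1 := pow_le_one₀ (by norm_num) (by norm_num)
    set a : ℝ := ((m : ℝ) - 1) + 2 * q with ha
    have hside : ((iterSide m k : ℝ) + 1) = t * a := by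
      have e1 : (iterSide m k : ℝ) = t * ((m : ℝ) - 1) + 1 := by
        unfold iterSide; push_cast [Nat.cast_sub hm]; rw [ht]
      rw [e1, ha, mul_add, ← mul_assoc, mul_comm t 2, mul_assoc 2 t q, htq]
      ring
    have h16 : (16 : ℝ) ^ k = t ^ 4 := by
      rw [ht, ← pow_mul, mul_comm, pow_mul]; norm_num
    have ht4 : (0 : ℝ) < t ^ 4 := by positivity
    -- `t^4 log Z_m ≤ t^4 (a^4 f + q K' a^3)`
    have hc : t ^ 4 * Real.log (zdPartitionFunction r.ρ β (halfOpenBox 4 m)).toReal ≤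
        t ^ 4 * (a ^ 4 * f + q * (K' * a ^ 3)) := by
      have rhs : t ^ 4 * (a ^ 4 * f + q * (K' * a ^ 3)) = (t * a) ^ 4 * f + K' * (t * a) ^ 3 := by
        have e2 : t ^ 4 * q = t ^ 3 := by
          rw [show t ^ 4 = t ^ 3 * t by ring, mul_assoc, htq, mul_one]
        calc t ^ 4 * (a ^ 4 * f + q * (K' * a ^ 3))
            = t ^ 4 * a ^ 4 * f + (t ^ 4 * q) * (K' * a ^ 3) := by ring
          _ = t ^ 4 * a ^ 4 * f + t ^ 3 * (K' * a ^ 3) := by rw [e2]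
          _ = (t * a) ^ 4 * f + K' * (t * a) ^ 3 := by ring
      rw [rhs, ← hside, ← h16]
      exact h1.trans h3
    have h6 := le_of_mul_le_mul_left hc ht4
    have hA : ((m : ℝ) - 1) ^ 4 ≤ a ^ 4 := pow_le_pow_left₀ hm1 (by rw [ha]; linarith) 4
    have hB : a ^ 3 ≤ ((m : ℝ) + 1) ^ 3 := pow_le_pow_left₀ (by rw [ha]; positivity) (by rw [ha]; linarith) 3
    have h7 : a ^ 4 * f ≤ ((m : ℝ) - 1) ^ 4 * f := mul_le_mul_of_nonpos_right hA hf0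
    have h8 : q * (K' * a ^ 3) ≤ K' * ((m : ℝ) + 1) ^ 3 * q := by
      have := mul_le_mul_of_nonneg_left (mul_le_mul_of_nonneg_left hB hK'0) hq0
      linarith
    linarith
  -- `k → ∞`
  have hlim : Tendsto (fun k : ℕ => ((m : ℝ) - 1) ^ 4 * f + K' * ((m : ℝ) + 1) ^ 3 * (1 / 2 : ℝ) ^ k) atTop
      (𝓝 (((m : ℝ) - 1) ^ 4 * f + K' * ((m : ℝ) + 1) ^ 3 * 0)) :=
    tendsto_const_nhds.add (tendsto_const_nhds.mul
      (tendsto_pow_atTop_nhds_zero_of_lt_one (by norm_num) (by norm_num)))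
  rw [mul_zero, add_zero] at hlim
  exact ge_of_tendsto' hlim hk

/-- **One-sided periodisation, no `β`-cost**: `log Z_{Λ_{n+2},β} ≤ log Z(B_{n+1})` for `β ≥ 0` — dropping the torus
plaquettes outside the periodised free cube `[0, n]⁴` only RAISES the integral (each weight is `≤ 1`). -/
theorem torusLogPartition_le_log_freeCube [SecondCountableTopology G] {N : ℕ} (ρ : G →* Matrix (Fin N) (Fin N) ℂ)
    (hρ : Continuous ρ) (hρN : ∀ g, (ρ g).trace.re ≤ N) {β : ℝ} (hβ : 0 ≤ β) (n : ℕ) :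
    torusLogPartition 4 ρ β (n + 2) ≤ Real.log (zdPartitionFunction ρ β (halfOpenBox 4 (n + 1))).toReal := by
  classical
  set I' : Finset (ZdPlaquette 4) := ChatterjeeFreeEnergy.cubePlaqs 4 (n + 1) with hI'def
  have hI' : ∀ p ∈ I', ∀ k, 0 ≤ p.1 k ∧ p.1 k + 2 ≤ ((n + 2 : ℕ) : ℤ) := by
    intro p hp k
    have hb := (FreeEnergy.mem_boxPlaqs (d := 4)).1 (ChatterjeeFreeEnergy.cubePlaqs_subset (d := 4) (n + 1) hp) k
    push_cast
    omega
  set P : Measure (GaugeConfig 4 (n + 2) G) :=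
    Measure.pi fun _ => haarProbability G with hP
  -- the torus integral is dominated by the integral of the kept plaquettes
  have hdom : (partitionFunction (d := 4) (L := n + 2) ρ β).toReal ≤
      ∫ U, ∏ p ∈ I'.image (fun p : ZdPlaquette 4 => ((Torus.proj (n + 2) p.1, p.2) : Plaquette 4 (n + 2))),
        Real.exp (-β * plaquetteCost ρ U p) ∂P := by
    rw [FreeEnergy.partitionFunction_eq_ofReal_integral ρ hρ β,
      ENNReal.toReal_ofReal (integral_nonneg fun U => Finset.prod_nonneg fun _ _ => (Real.exp_pos _).le)]
    refine integral_mono (FreeEnergy.integrable_torusWeight ρ hρ β _) (FreeEnergy.integrable_torusWeight ρ hρ β _)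
      fun U => ?_
    have hle1 : ∀ p : Plaquette 4 (n + 2), Real.exp (-β * plaquetteCost ρ U p) ≤ 1 := by
      intro p
      rw [Real.exp_le_one_iff]
      have hc : 0 ≤ plaquetteCost ρ U p := by
        unfold plaquetteCost
        linarith [hρN (plaquetteHolonomy U p.1 p.2.1.1 p.2.1.2)]
      nlinarith
    show ∏ p ∈ Finset.univ, Real.exp (-β * plaquetteCost ρ U p) ≤ _
    rw [← Finset.prod_mul_prod_compl (I'.image (fun p : ZdPlaquette 4 =>
      ((Torus.proj (n + 2) p.1, p.2) : Plaquette 4 (n + 2))))]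
    exact mul_le_of_le_one_right (Finset.prod_nonneg fun _ _ => (Real.exp_pos _).le)
      (Finset.prod_le_one (fun _ _ => (Real.exp_pos _).le) fun p _ => hle1 p)
  rw [FreeEnergy.integral_torusWeight_image ρ hρ β hI'] at hdom
  rw [torusLogPartition, ChatterjeeFreeEnergy.zdPartitionFunction_toReal_eq ρ hρ β (n + 1)]
  refine Real.log_le_log ?_ hdom
  rw [toReal_partitionFunction_eq_wilsonFinTorusPartition hρ]
  exact wilsonFinTorusPartition_pos hρ β _ _ _ _

/-- **Torus ceiling under RP doubling**: `log Z_{Λ_L,β} ≤ (L − 2)⁴ f(β)` for `β ≥ 0`, `L ≥ 2`. -/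
theorem torusLogPartition_le_of_doubling (r : LatticeRep G) {β : ℝ} (hβ : 0 ≤ β) (hD : FreeCubeRPDoubling r.ρ β)
    (L : ℕ) [NeZero L] (hL : 2 ≤ L) :
    torusLogPartition 4 r.ρ β L ≤ ((L : ℝ) - 2) ^ 4 * freeEnergyDensity 4 r.ρ β := by
  haveI : SecondCountableTopology G :=
    (r.continuous.isClosedEmbedding r.injective).isEmbedding.secondCountableTopology
  have hρN : ∀ g, (r.ρ g).trace.re ≤ (r.N : ℝ) := fun g => by
    have := Literature.RepresentationTheory.CompactGroups.CompactGroup.abs_re_trace_le_card r.ρ r.continuous g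
    simp only [Fintype.card_fin] at this
    exact (abs_le.1 this).2
  obtain ⟨n, rfl⟩ : ∃ n, L = n + 2 := ⟨L - 2, by omega⟩
  have h1 := torusLogPartition_le_log_freeCube r.ρ r.continuous hρN hβ n
  have h2 := log_freeCube_le_of_doubling r hβ hD (m := n + 1) le_add_self
  push_cast at h2 ⊢
  have e : ((n : ℝ) + 1 - 1) = ((n : ℝ) + 2 - 2) := by ring
  rw [e] at h2
  exact h1.trans h2

/-- **The doubling hypothesis for all groups, representations and `β ≥ 0`** (what site-reflection positivity of the
product Haar measure gives; the one typed input of §5). -/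
def FreeCubeRPDoublingAll : Prop :=
  ∀ (G : Type) [Group G] [TopologicalSpace G] [IsTopologicalGroup G] [CompactSpace G] [MeasurableSpace G]
    [BorelSpace G] (r : LatticeRep G) (β : ℝ), 0 ≤ β → FreeCubeRPDoubling r.ρ β

/-- **The LOGARITHMIC volume floor** `⌈log β⌉₊ + 2` (representation-independent). -/
def logFloor (β : ℝ) : ℕ := ⌈Real.log β⌉₊ + 2

/-- The logarithmic floor is below the linear one: `⌈log β⌉₊ + 2 ≤ ⌈β⌉₊ + 2` for `β ≥ 0`. -/
theorem logFloor_le_linFloor {β : ℝ} (hβ : 0 ≤ β) : logFloor β ≤ linFloor β := by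
  unfold logFloor linFloor
  have h : Real.log β ≤ β := by
    rcases hβ.eq_or_lt with h0 | hpos
    · rw [← h0, Real.log_zero]
    · exact (Real.log_le_sub_one_of_pos hpos).trans (by linarith)
  exact Nat.add_le_add_right (Nat.ceil_mono h) 2

/-- **The increment bound above the logarithmic floor**, from any asymptotic `f(β) + c log β → K` and the doubling
hypothesis at every `β ≥ 0`: `log Z_L(β') − log Z_L(β) ≤ c L⁴ log(β/β') + C L⁴` for `β₃ ≤ β' ≤ β`, `L ≥ ⌈log β⌉₊ + 2`
(ceiling at `β'`: `(L−2)⁴ f(β')`, i.e. excess `≤ 8L³|f(β')| ≤ 8L³(|c| log β' + |1−K|) ≤ 8(|c|+|1−K|) L⁴` since `log β' ≤ L`;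
floor at `β`: exact). -/
theorem increment_bound_log_of_tendsto (r : LatticeRep G) {c K : ℝ}
    (hK : Tendsto (fun β : ℝ => freeEnergyDensity 4 r.ρ β + c * Real.log β) atTop (𝓝 K))
    (hD : ∀ β : ℝ, 0 ≤ β → FreeCubeRPDoubling r.ρ β) :
    ∃ C β₃ : ℝ, 0 < β₃ ∧ ∀ (L : ℕ) [NeZero L] (β' β : ℝ), β₃ ≤ β' → β' ≤ β → logFloor β ≤ L →
      torusLogPartition 4 r.ρ β' L - torusLogPartition 4 r.ρ β L ≤
        c * (L : ℝ) ^ 4 * Real.log (β / β') + C * (L : ℝ) ^ 4 := by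
  obtain ⟨N₀, hN₀⟩ := (Metric.tendsto_atTop.1 hK) 1 one_pos
  refine ⟨2 + 8 * (|c| + |1 - K|), max N₀ 1, lt_of_lt_of_le one_pos (le_max_right _ _),
    fun L _ β' β hβ' hβ'β hfl => ?_⟩
  have hβ'1 : 1 ≤ β' := le_trans (le_max_right _ _) hβ'
  have hβ'0 : 0 < β' := by linarith
  have hβ0 : 0 < β := by linarith
  have hL2 : 2 ≤ L := le_trans (by unfold logFloor; omega) hfl
  have hL1 : (1 : ℝ) ≤ (L : ℝ) := by exact_mod_cast (le_trans one_le_two hL2)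
  have hlogβ' : 0 ≤ Real.log β' := Real.log_nonneg hβ'1
  have hLlog : Real.log β' ≤ (L : ℝ) := by
    have h1 : Real.log β ≤ (⌈Real.log β⌉₊ : ℝ) := Nat.le_ceil _
    have h2 : ((⌈Real.log β⌉₊ + 2 : ℕ) : ℝ) ≤ (L : ℝ) := by exact_mod_cast hfl
    have h3 : Real.log β' ≤ Real.log β := Real.log_le_log hβ'0 hβ'β
    push_cast at h2
    linarith
  have hL3 : (0 : ℝ) ≤ (L : ℝ) ^ 3 := by positivity
  have hL4 : (0 : ℝ) ≤ (L : ℝ) ^ 4 := by positivity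
  -- the two Chatterjee windows
  have hw' := hN₀ β' (le_trans (le_max_left _ _) hβ')
  have hw := hN₀ β (le_trans (le_trans (le_max_left _ _) hβ') hβ'β)
  rw [Real.dist_eq] at hw hw'
  have hf : freeEnergyDensity 4 r.ρ β' - freeEnergyDensity 4 r.ρ β ≤ c * Real.log (β / β') + 2 := by
    rw [Real.log_div hβ0.ne' hβ'0.ne']
    have a1 := (abs_lt.1 hw').2
    have a2 := (abs_lt.1 hw).1
    nlinarith
  have hnegf : -freeEnergyDensity 4 r.ρ β' ≤ |c| * Real.log β' + |1 - K| := by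
    have a1 := (abs_lt.1 hw').1
    have b1 : c * Real.log β' ≤ |c| * Real.log β' := mul_le_mul_of_nonneg_right (le_abs_self c) hlogβ'
    have b2 : 1 - K ≤ |1 - K| := le_abs_self _
    linarith
  have hf'0 : 0 ≤ -freeEnergyDensity 4 r.ρ β' := by linarith [freeEnergyDensity_nonpos r hβ'0.le]
  -- ceiling at `β'` (RP doubling), floor at `β` (transfer matrix)
  have hceil := torusLogPartition_le_of_doubling r hβ'0.le (hD β' hβ'0.le) L hL2
  have hfloor := volume_mul_freeEnergyDensity_le_torusLogPartition r hβ0.le L hL2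
  -- `(L-2)^4 f' = L^4 f' + (L^4 - (L-2)^4)(-f')` and `L^4 - (L-2)^4 ≤ 8 L^3`
  have hpoly : (L : ℝ) ^ 4 - ((L : ℝ) - 2) ^ 4 ≤ 8 * (L : ℝ) ^ 3 := by nlinarith
  have hpoly0 : 0 ≤ (L : ℝ) ^ 4 - ((L : ℝ) - 2) ^ 4 := by
    have : ((L : ℝ) - 2) ^ 4 ≤ (L : ℝ) ^ 4 :=
      pow_le_pow_left₀ (by have : (2:ℝ) ≤ L := by exact_mod_cast hL2
                           linarith) (by linarith) 4
    linarith
  have hex : ((L : ℝ) - 2) ^ 4 * freeEnergyDensity 4 r.ρ β' ≤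
      (L : ℝ) ^ 4 * freeEnergyDensity 4 r.ρ β' + 8 * (L : ℝ) ^ 3 * (|c| * Real.log β' + |1 - K|) := by
    have step1 : ((L : ℝ) - 2) ^ 4 * freeEnergyDensity 4 r.ρ β' =
        (L : ℝ) ^ 4 * freeEnergyDensity 4 r.ρ β' + ((L : ℝ) ^ 4 - ((L : ℝ) - 2) ^ 4) * (-freeEnergyDensity 4 r.ρ β') := by
      ring
    rw [step1]
    have step2 : ((L : ℝ) ^ 4 - ((L : ℝ) - 2) ^ 4) * (-freeEnergyDensity 4 r.ρ β') ≤
        8 * (L : ℝ) ^ 3 * (-freeEnergyDensity 4 r.ρ β') := mul_le_mul_of_nonneg_right hpoly hf'0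
    have step3 : 8 * (L : ℝ) ^ 3 * (-freeEnergyDensity 4 r.ρ β') ≤ 8 * (L : ℝ) ^ 3 * (|c| * Real.log β' + |1 - K|) :=
      mul_le_mul_of_nonneg_left hnegf (by positivity)
    linarith
  -- `8 L^3 (|c| log β' + |1-K|) ≤ 8 (|c| + |1-K|) L^4`
  have hb : 8 * (L : ℝ) ^ 3 * (|c| * Real.log β' + |1 - K|) ≤ 8 * (|c| + |1 - K|) * (L : ℝ) ^ 4 := by
    have u1 : |c| * Real.log β' ≤ |c| * (L : ℝ) := mul_le_mul_of_nonneg_left hLlog (abs_nonneg c)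
    have u2 : |1 - K| ≤ |1 - K| * (L : ℝ) := le_mul_of_one_le_right (abs_nonneg _) hL1
    have u3 : |c| * Real.log β' + |1 - K| ≤ (|c| + |1 - K|) * (L : ℝ) := by nlinarith
    have := mul_le_mul_of_nonneg_left u3 (show (0:ℝ) ≤ 8 * (L : ℝ) ^ 3 by positivity)
    nlinarith
  have hmain : (L : ℝ) ^ 4 * (freeEnergyDensity 4 r.ρ β' - freeEnergyDensity 4 r.ρ β) ≤
      (L : ℝ) ^ 4 * (c * Real.log (β / β') + 2) := mul_le_mul_of_nonneg_left hf hL4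
  nlinarith

/-- **(FE) ABOVE THE LOGARITHMIC FLOOR, conditional on free-cube RP doubling** (`ν₀ = 3D/2` from the tree's
`freeEnergyLogCoefficient_proof`; the doubling is the only hypothesis).  With idea-4's engine this gives the β-uniform
large-field rarity on all odd tori `2S+1 ≥ ⌈log β⌉₊ + 2`. -/
theorem freeEnergyIncrementFrom_logFloor (hD : FreeCubeRPDoublingAll) : FreeEnergyIncrementFrom logFloor := by
  intro G _ _ _ _ hG
  letI : MeasurableSpace G := borel G
  haveI : BorelSpace G := ⟨rfl⟩
  intro r
  obtain ⟨K, hK⟩ := Summit.QuantumFields.YangMills.Theorems.freeEnergyLogCoefficient_proof G hG r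
  obtain ⟨C, β₃, hβ₃, h⟩ := increment_bound_log_of_tendsto r hK (fun β hβ => hD G r β hβ)
  exact ⟨_, C, β₃, hβ₃, h⟩

end LogFloor

end Summit.QuantumFields.YangMills.Cruxes.IR.PressureMonotoneTM

/-! ## §6 The hook: `FreeCubeRPDoublingAll` holds, so (FE) above the LOGARITHMIC floor is unconditional -/

namespace Summit.QuantumFields.YangMills.Cruxes.IR.PressureMonotoneTM

open Summit.QuantumFields.YangMills.Cruxes.IR.LargeFieldRarityChessboard (FreeEnergyIncrementFrom)

open Literature.MathematicalPhysics.QuantumFieldTheory in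
/-- **Glimm–Jaffe multiple reflections for the free Wilson cubes** (Part B): `Z(B_m)^16 ≤ Z(B_{2m-1})` for every compact
`G`, every lattice representation, every `β ≥ 0`, `m ≥ 1`. -/
theorem freeCubeRPDoublingAll_holds : FreeCubeRPDoublingAll := by
  intro G _ _ _ _ _ _ r β hβ
  haveI : SecondCountableTopology G :=
    (r.continuous.isClosedEmbedding r.injective).isEmbedding.secondCountableTopology
  have hM : ∀ g, |(r.ρ g).trace.re| ≤ (r.N : ℝ) := fun g => by
    simpa [Fintype.card_fin] using
      Literature.RepresentationTheory.CompactGroups.CompactGroup.abs_re_trace_le_card r.ρ r.continuous g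
  exact fun m hm => RPDoubling.zdPartitionFunction_halfOpenBox_pow_sixteen_le r.ρ β r.continuous
    (fun g => (abs_le.1 (hM g)).2) hβ hm

/-- **(FE) above the logarithmic floor, UNCONDITIONAL**: for every compact simple `G` and lattice representation `r`
there are `c, C ≥ 0`, `β₃ > 0` with `log Z_{Λ_{2S+1},β'} − log Z_{Λ_{2S+1},β} ≤ c (2S+1)⁴ log(β/β') + C (2S+1)⁴` for all
`β₃ ≤ β' ≤ β` and all odd tori `2S+1 ≥ ⌈log β⌉₊ + 2` (idea-4's `FreeEnergyIncrementFrom`, mirrored verbatim, at the floor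
`logFloor`). -/
theorem freeEnergyIncrementFrom_logFloor_holds : FreeEnergyIncrementFrom logFloor :=
  freeEnergyIncrementFrom_logFloor freeCubeRPDoublingAll_holds

end Summit.QuantumFields.YangMills.Cruxes.IR.PressureMonotoneTM

end
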